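import Literature.Topology.FourManifolds.MilnorBoxSurface
import Literature.Topology.FourManifolds.OrientationChartSign
import Mathlib.Analysis.SpecialFunctions.Complex.Arg
import Mathlib.Analysis.SpecialFunctions.Trigonometric.Deriv
import HarnessLib

/-!
# The level just below the lowest saddle of a Morse function on a closed surface is a circle

Topic `Literature/Topology/FourManifolds` (infrastructure for the dimension-`2` leaf of
`Literature.Topology.FourManifolds.HomotopySphere.contractibleSpace_compl_image_ball`; consumed by
`SaddleLevelDisconnected.lean`).  Everything here is **proved**.

Setting (`Literature.Topology.FourManifolds.LowestSaddle`): a closed smooth surface `M`, a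
Morse function `f` with smooth gradient-like field `ξ` (Milnor, *Lectures on the h-cobordism
theorem* (1965), Def. 3.1), a minimum `p` and a saddle `s` of `f` with Milnor boxes (Def. 3.1
(2)), such that every other critical point has value `≥ f(s) + η`: `s` is *the lowest saddle,
alone on its level, and `p` the only critical point below it*; plus small parameters
`κ, δ, ρ`.  We study the level `L'' = f⁻¹(c - κ)`, `c = f(s)`, through the flow:

* the chart circle `σ θ = φ_p⁻¹(ρ cos θ, ρ sin θ)` about the minimum is the whole level
  `f = f(p) + ρ²` (`MilnorBox.mem_source_and_norm_coord_eq`, `MilnorBoxSurface.lean`;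
  Milnor's proof of Thm. 3.12), a smooth `2π`-periodic curve, injective on a period, with nowhere
  vanishing velocity;
* flowing it up to the level `c - κ` (no critical value in between; the level-to-level map
  `levelProj` of `RegularLevelFlowMap.lean`, Milnor's Thm. 3.4) gives **a smooth `2π`-periodic
  parametrisation `h = levelCurve` of `L''`, injective on a period, onto `L''`, with nowhere
  vanishing velocity `ḣ`** (`levelCurve_*`);
* **the moving frame `(ξ (h θ), ḣ θ)` is nowhere degenerate** (`det_frame_levelCurve_ne_zero`:
  `df(ḣ) = 0 < df(ξ)`), so its orientation character is constant along `h` for any smooth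
  orientation (`OrientationChartSign.lean`);
* at the two points `e± = φ_s⁻¹(±√κ, 0)` where `L''` crosses the stable manifold of `s`
  (`MilnorBox.eq_ePt_or_of_tendsto`), the velocity of `h` read in the saddle chart is vertical:
  `dφ_s(ḣ) = (0, b)` with `b ≠ 0` (`xc_deriv_eq_zero`), while `dφ_s(ξ) = (∓√κ, 0)`.

The orientation argument proper (opposite signs of `b` at `e₊` and `e₋`, hence the handle at
`s` is attached untwisted and the level above `s` is disconnected) is carried out in
`SaddleLevelDisconnected.lean`.

## References

* J. Milnor, *Lectures on the h-cobordism theorem*, Princeton (1965), Def. 3.1, Thm. 3.4,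
  proof of Thm. 3.12 (PDF p. 18), Thm. 4.1 (PDF p. 22). [MilnorHCobordism1965]
* Y. Matsumoto, *An Introduction to Morse Theory*, AMS (2001), §2.3 (c), Thm. 3.1, and the
  discussion of handles of index `1` on surfaces, §1.5(b) (PDF pp. 48–49, Fig. 1.15–1.17). [Matsumoto2001]
-/

open scoped Manifold ContDiff Topology
open Set Function Filter Metric Module

noncomputable section

namespace Literature.Topology.FourManifolds

open Flow MilnorBox

/-- Local notation: `𝔼 n` is the model Euclidean space `EuclideanSpace ℝ (Fin n)`. -/
local notation "𝔼 " n:arg => EuclideanSpace ℝ (Fin n)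

/-! ### Reaching a level: intermediate value theorem with the limit of the trajectory -/

section Reach

variable {m : ℕ} {H : Type*} [TopologicalSpace H] {J : ModelWithCorners ℝ (𝔼 m) H}
  {M : Type*} [TopologicalSpace M] [ChartedSpace H M] [IsManifold J ∞ M]
  [T2Space M] [CompactSpace M] [BoundarylessManifold J M]
  {f : M → ℝ} {ξ : Π x : M, TangentSpace J x}

/-- If the trajectory of `z` converges forwards to `r` with `f z ≤ b < f r`, it meets the
level `b` at a time `t ≥ 0`. [cite: Matsumoto2001, §2.3 (c) (PDF p. 74)] -/
theorem exists_flow_eq_of_tendsto_atTop (hfM : IsMorse J f)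
    (hξ : ContMDiff J J.tangent ∞ fun x => (⟨x, ξ x⟩ : TangentBundle J M)) {z r : M} {b : ℝ}
    (hlim : Tendsto (flow hξ z) atTop (𝓝 r)) (hzb : f z ≤ b) (hbr : b < f r) :
    ∃ t : ℝ, 0 ≤ t ∧ f (flow hξ z t) = b := by
  have hlimf : Tendsto (f ∘ flow hξ z) atTop (𝓝 (f r)) :=
    (hfM.contMDiff.continuous.tendsto r).comp hlim
  obtain ⟨T, hT⟩ := eventually_atTop.1 (hlimf.eventually (eventually_gt_nhds hbr))
  have hT' : b < f (flow hξ z (max T 0)) := hT _ (le_max_left _ _)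
  have hcont : ContinuousOn (f ∘ flow hξ z) (Icc 0 (max T 0)) :=
    (hfM.contMDiff.continuous.comp (continuous_flow hξ z)).continuousOn
  obtain ⟨t, ht, hft⟩ := intermediate_value_Icc (le_max_right T 0) hcont
    ⟨by simpa [flow_zero] using hzb, hT'.le⟩
  exact ⟨t, ht.1, hft⟩

/-- If the trajectory of `z` converges backwards to `r` with `f r < b ≤ f z`, it met the level
`b` at a time `t ≤ 0`. [cite: Matsumoto2001, §2.3 (c) (PDF p. 74)] -/
theorem exists_flow_eq_of_tendsto_atBot (hfM : IsMorse J f)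
    (hξ : ContMDiff J J.tangent ∞ fun x => (⟨x, ξ x⟩ : TangentBundle J M)) {z r : M} {b : ℝ}
    (hlim : Tendsto (flow hξ z) atBot (𝓝 r)) (hbz : b ≤ f z) (hrb : f r < b) :
    ∃ t : ℝ, t ≤ 0 ∧ f (flow hξ z t) = b := by
  have hlimf : Tendsto (f ∘ flow hξ z) atBot (𝓝 (f r)) :=
    (hfM.contMDiff.continuous.tendsto r).comp hlim
  obtain ⟨T, hT⟩ := eventually_atBot.1 (hlimf.eventually (eventually_lt_nhds hrb))
  have hT' : f (flow hξ z (min T 0)) < b := hT _ (min_le_left _ _)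
  have hcont : ContinuousOn (f ∘ flow hξ z) (Icc (min T 0) 0) :=
    (hfM.contMDiff.continuous.comp (continuous_flow hξ z)).continuousOn
  obtain ⟨t, ht, hft⟩ := intermediate_value_Icc (min_le_right T 0) hcont
    ⟨hT'.le, by simpa [flow_zero] using hbz⟩
  exact ⟨t, ht.2, hft⟩

end Reach

/-! ### The configuration: the lowest saddle and the minimum below it -/

section Config

variable {M : Type*} [TopologicalSpace M] [ChartedSpace (𝔼 2) M] [IsManifold (𝓡 2) ∞ M]

/-- **The lowest saddle of a Morse function on a closed surface, with the minimum below it.**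
Data: a Morse function `f` with a smooth gradient-like field `ξ`; a critical point `pmin` with
a Milnor box of index `0` and a critical point `sad` with a Milnor box of index `1` (Milnor
1965, Def. 3.1 (2)); a gap `η > 0` such that every other critical point has value
`≥ f(sad) + η` (so `pmin` is the only critical point below `sad`, and `sad` is alone on its
level); and parameters `κ, δ` (`< η`, `< ε_sad²`) for the levels `f(sad) ∓ κ, δ` and `ρ` for
the circle `f = f(pmin) + ρ²` inside the box of the minimum, below the level `f(sad) - κ`. [cite: MilnorHCobordism1965, Def. 3.1 (2) and Thm. 3.4] -/
structure LowestSaddle (f : M → ℝ) (ξ : Π x : M, TangentSpace (𝓡 2) x) where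
  /-- the minimum -/
  pmin : M
  /-- the saddle -/
  sad : M
  /-- Milnor box about the minimum -/
  Dmin : MilnorBox (𝓡 2) f ξ pmin
  /-- Milnor box about the saddle -/
  Dsad : MilnorBox (𝓡 2) f ξ sad
  /-- `f` is Morse -/
  isMorse : IsMorse (𝓡 2) f
  /-- `ξ` is gradient-like for `f` -/
  isGradientLike : IsGradientLike (𝓡 2) f ξ
  /-- `ξ` is smooth -/
  contMDiff : ContMDiff (𝓡 2) (𝓡 2).tangent ∞ fun x => (⟨x, ξ x⟩ : TangentBundle (𝓡 2) M)
  kmin : Dmin.k = 0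
  ksad : Dsad.k = 1
  /-- the gap above the saddle value -/
  η : ℝ
  /-- the lower level is `f sad - κ` -/
  κ : ℝ
  /-- the upper level is `f sad + δ` -/
  δ : ℝ
  /-- the radius of the circle about the minimum -/
  ρ : ℝ
  η_pos : 0 < η
  κ_pos : 0 < κ
  δ_pos : 0 < δ
  ρ_pos : 0 < ρ
  κ_lt_η : κ < η
  δ_lt_η : δ < η
  κ_lt : κ < Dsad.ε ^ 2
  δ_lt : δ < Dsad.ε ^ 2
  ρ_lt : ρ ^ 2 < 4 * Dmin.ε ^ 2
  base_lt : f pmin + ρ ^ 2 < f sad - κ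
  crit_ge : ∀ q, IsMCriticalPt (𝓡 2) f q → q ≠ pmin → q ≠ sad → f sad + η ≤ f q

namespace LowestSaddle

variable {f : M → ℝ} {ξ : Π x : M, TangentSpace (𝓡 2) x} (S : LowestSaddle f ξ)

/-- The level of the circle about the minimum. [folklore] -/
def base : ℝ := f S.pmin + S.ρ ^ 2

/-- The lower level `c - κ`. [folklore] -/
def lo : ℝ := f S.sad - S.κ

/-- The upper level `c + δ`. [folklore] -/
def hi : ℝ := f S.sad + S.δ

/-- `base < lo`. [folklore] -/
theorem base_lt_lo : S.base < S.lo := S.base_lt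

/-- `lo < f sad`. [folklore] -/
theorem lo_lt_sad : S.lo < f S.sad := by unfold lo; linarith [S.κ_pos]

/-- `f sad < hi`. [folklore] -/
theorem sad_lt_hi : f S.sad < S.hi := by unfold hi; linarith [S.δ_pos]

/-- `f pmin < base`. [folklore] -/
theorem min_lt_base : f S.pmin < S.base := by unfold base; nlinarith [S.ρ_pos]

/-- `hi < f sad + η`. [folklore] -/
theorem hi_lt_gap : S.hi < f S.sad + S.η := by unfold hi; linarith [S.δ_lt_η]

/-- The minimum is a critical point. [cite: MilnorHCobordism1965, Def. 3.1 (2)] -/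
theorem isMCriticalPt_pmin : IsMCriticalPt (𝓡 2) f S.pmin :=
  (isMCriticalPt_and_morseIndex_eq_of_eq_milnorQuadratic
    (S.isMorse.contMDiff.contMDiffAt.of_le (by norm_cast)) S.Dmin.mem_maximalAtlas S.Dmin.mem_source
    BoundarylessManifold.isInteriorPoint S.Dmin.apply_eq).1

/-- The saddle is a critical point. [cite: MilnorHCobordism1965, Def. 3.1 (2)] -/
theorem isMCriticalPt_sad : IsMCriticalPt (𝓡 2) f S.sad :=
  (isMCriticalPt_and_morseIndex_eq_of_eq_milnorQuadratic
    (S.isMorse.contMDiff.contMDiffAt.of_le (by norm_cast)) S.Dsad.mem_maximalAtlas S.Dsad.mem_source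
    BoundarylessManifold.isInteriorPoint S.Dsad.apply_eq).1

/-- **Trichotomy of critical points**: the minimum, the saddle, or above the gap. [folklore] -/
theorem crit_cases {q : M} (hq : IsMCriticalPt (𝓡 2) f q) :
    q = S.pmin ∨ q = S.sad ∨ f S.sad + S.η ≤ f q := by
  by_cases h1 : q = S.pmin
  · exact Or.inl h1
  by_cases h2 : q = S.sad
  · exact Or.inr (Or.inl h2)
  exact Or.inr (Or.inr (S.crit_ge q hq h1 h2))

/-- A critical point with value below the gap and other than the saddle value is the minimum. [folklore] -/
theorem eq_pmin_of_lt {q : M} (hq : IsMCriticalPt (𝓡 2) f q) (hlt : f q < f S.sad + S.η)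
    (hne : f q ≠ f S.sad) : q = S.pmin := by
  rcases S.crit_cases hq with h | h | h
  · exact h
  · exact absurd (congrArg f h) hne
  · exact absurd h (not_le.2 hlt)

/-- No critical value in `[base, lo]`. [folklore] -/
theorem not_mem_Icc_base_lo {q : M} (hq : IsMCriticalPt (𝓡 2) f q) : f q ∉ Icc S.base S.lo := by
  intro hmem
  rcases S.crit_cases hq with h | h | h
  · rw [h] at hmem; exact absurd hmem.1 (not_le.2 S.min_lt_base)
  · rw [h] at hmem; exact absurd hmem.2 (not_le.2 S.lo_lt_sad)
  · have := S.hi_lt_gap; have := S.sad_lt_hi; have := S.lo_lt_sad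
    linarith [hmem.2]

/-- No critical point on the level `base`. [folklore] -/
theorem not_isMCriticalPt_of_base {x : M} (hx : f x = S.base) : ¬ IsMCriticalPt (𝓡 2) f x :=
  fun h => S.not_mem_Icc_base_lo h ⟨hx.ge, by rw [hx]; exact S.base_lt_lo.le⟩

/-- No critical point on the level `lo`. [folklore] -/
theorem not_isMCriticalPt_of_lo {x : M} (hx : f x = S.lo) : ¬ IsMCriticalPt (𝓡 2) f x :=
  fun h => S.not_mem_Icc_base_lo h ⟨by rw [hx]; exact S.base_lt_lo.le, hx.le⟩

/-- No critical point on the level `hi`. [folklore] -/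
theorem not_isMCriticalPt_of_hi {x : M} (hx : f x = S.hi) : ¬ IsMCriticalPt (𝓡 2) f x := by
  intro h
  rcases S.crit_cases h with h' | h' | h'
  · rw [h'] at hx; have := S.min_lt_base; have := S.base_lt_lo; have := S.lo_lt_sad
    have := S.sad_lt_hi; linarith
  · rw [h'] at hx; exact absurd hx (ne_of_lt S.sad_lt_hi)
  · rw [hx] at h'; exact absurd h' (not_le.2 S.hi_lt_gap)

/-- `!₂[a, b] = a • e₀ + b • e₁`. [folklore] -/
theorem euclideanTwo_eq_smul_add_smul (a b : ℝ) :
    (!₂[a, b] : 𝔼 2) = a • EuclideanSpace.single 0 1 + b • EuclideanSpace.single 1 1 := by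
  ext i; fin_cases i <;> simp

/-- `‖!₂[a, b]‖² = a² + b²`. [folklore] -/
theorem norm_sq_euclideanTwo (a b : ℝ) : ‖(!₂[a, b] : 𝔼 2)‖ ^ 2 = a ^ 2 + b ^ 2 := by
  rw [EuclideanSpace.norm_sq_eq, Fin.sum_univ_two]
  simp [sq_abs]

/-- **Polar coordinates**: a vector of `ℝ²` of norm `ρ` is `(ρ cos θ, ρ sin θ)`. [folklore] -/
theorem exists_eq_polar {u : 𝔼 2} {ρ : ℝ} (hu : ‖u‖ = ρ) :
    ∃ θ : ℝ, u = !₂[ρ * Real.cos θ, ρ * Real.sin θ] := by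
  set z : ℂ := ⟨u 0, u 1⟩ with hz
  have hnorm : ‖z‖ = ρ := by
    have h1 : ‖z‖ ^ 2 = ρ ^ 2 := by
      rw [Complex.sq_norm, Complex.normSq_mk, ← hu, ← euclideanTwo_eta u, norm_sq_euclideanTwo]
      simp; ring
    have hρ : 0 ≤ ρ := hu ▸ norm_nonneg _
    exact (sq_eq_sq₀ (norm_nonneg _) hρ).1 h1
  refine ⟨Complex.arg z, ?_⟩
  rw [← hnorm, Complex.norm_mul_cos_arg, Complex.norm_mul_sin_arg]
  exact (euclideanTwo_eta u).symm

/-- The model circle `θ ↦ (ρ cos θ, ρ sin θ)`. [folklore] -/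
def circleVec (θ : ℝ) : 𝔼 2 := !₂[S.ρ * Real.cos θ, S.ρ * Real.sin θ]

/-- The velocity of the model circle, `(-ρ sin θ, ρ cos θ)`. [folklore] -/
def circleVel (θ : ℝ) : 𝔼 2 := !₂[-(S.ρ * Real.sin θ), S.ρ * Real.cos θ]

/-- `‖circleVec θ‖² = ρ²`. [folklore] -/
theorem norm_sq_circleVec (θ : ℝ) : ‖S.circleVec θ‖ ^ 2 = S.ρ ^ 2 := by
  unfold circleVec; rw [norm_sq_euclideanTwo]
  nlinarith [Real.sin_sq_add_cos_sq θ]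

/-- `‖circleVel θ‖² = ρ²`. [folklore] -/
theorem norm_sq_circleVel (θ : ℝ) : ‖S.circleVel θ‖ ^ 2 = S.ρ ^ 2 := by
  unfold circleVel; rw [norm_sq_euclideanTwo]
  nlinarith [Real.sin_sq_add_cos_sq θ]

/-- The model velocity never vanishes. [folklore] -/
theorem circleVel_ne_zero (θ : ℝ) : S.circleVel θ ≠ 0 := fun h => by
  have := S.norm_sq_circleVel θ
  rw [h, norm_zero] at this
  nlinarith [S.ρ_pos]

/-- The model circle lies in the model closed box of the minimum. [folklore] -/
theorem sqSum_circleVec_le (θ : ℝ) :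
    sqSumLT S.Dmin.k (S.circleVec θ) ≤ S.Dmin.ε ^ 2 ∧ sqSumGE S.Dmin.k (S.circleVec θ) ≤ 4 * S.Dmin.ε ^ 2 := by
  rw [S.kmin, sqSumLT_zero, sqSumGE_zero, S.norm_sq_circleVec]
  exact ⟨by positivity, S.ρ_lt.le⟩

/-- The model circle is differentiable with velocity `circleVel`. [folklore] -/
theorem hasDerivAt_circleVec (θ : ℝ) : HasDerivAt S.circleVec (S.circleVel θ) θ := by
  have h0 : HasDerivAt (fun θ => (S.ρ * Real.cos θ) • (EuclideanSpace.single 0 1 : 𝔼 2))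
      ((S.ρ * -Real.sin θ) • (EuclideanSpace.single 0 1 : 𝔼 2)) θ :=
    ((Real.hasDerivAt_cos θ).const_mul S.ρ).smul_const _
  have h1 : HasDerivAt (fun θ => (S.ρ * Real.sin θ) • (EuclideanSpace.single 1 1 : 𝔼 2))
      ((S.ρ * Real.cos θ) • (EuclideanSpace.single 1 1 : 𝔼 2)) θ :=
    ((Real.hasDerivAt_sin θ).const_mul S.ρ).smul_const _
  have h := h0.add h1
  have hfun : S.circleVec = fun θ => (S.ρ * Real.cos θ) • (EuclideanSpace.single 0 1 : 𝔼 2) +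
      (S.ρ * Real.sin θ) • (EuclideanSpace.single 1 1 : 𝔼 2) := by
    funext θ; exact euclideanTwo_eq_smul_add_smul _ _
  have hvel : S.circleVel θ = (S.ρ * -Real.sin θ) • (EuclideanSpace.single 0 1 : 𝔼 2) +
      (S.ρ * Real.cos θ) • (EuclideanSpace.single 1 1 : 𝔼 2) := by
    show (!₂[-(S.ρ * Real.sin θ), S.ρ * Real.cos θ] : 𝔼 2) = _
    rw [euclideanTwo_eq_smul_add_smul, show -(S.ρ * Real.sin θ) = S.ρ * -Real.sin θ by ring]
  rw [hfun, hvel]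
  exact h

/-- **The chart circle** `σ θ = φ_p⁻¹(ρ cos θ, ρ sin θ)` about the minimum. [cite: MilnorHCobordism1965, proof of Thm. 3.12 (PDF p. 18)] -/
def circlePt (θ : ℝ) : M := S.Dmin.pt (S.circleVec θ)

/-- The chart circle lies in the chart domain. [folklore] -/
theorem circlePt_mem_source (θ : ℝ) : S.circlePt θ ∈ S.Dmin.chart.source :=
  S.Dmin.pt_mem_source (S.sqSum_circleVec_le θ).1 (S.sqSum_circleVec_le θ).2

/-- The coordinates of the chart circle. [folklore] -/
theorem coord_circlePt (θ : ℝ) : S.Dmin.coord (S.circlePt θ) = S.circleVec θ :=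
  S.Dmin.coord_pt (S.sqSum_circleVec_le θ).1 (S.sqSum_circleVec_le θ).2

/-- The chart circle lies on the level `base = f(pmin) + ρ²`. [cite: MilnorHCobordism1965, Def. 3.1 (2)] -/
theorem apply_circlePt (θ : ℝ) : f (S.circlePt θ) = S.base := by
  have := (pt_of_k_eq_zero S.kmin (v := S.circleVec θ) (by rw [S.norm_sq_circleVec]; exact S.ρ_lt.le)).2.2
  unfold circlePt base
  rw [this, S.norm_sq_circleVec]

/-- The chart circle is `2π`-periodic. [folklore] -/
theorem circlePt_add_two_pi (θ : ℝ) : S.circlePt (θ + 2 * Real.pi) = S.circlePt θ := by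
  unfold circlePt circleVec
  rw [Real.cos_add_two_pi, Real.sin_add_two_pi]

/-- Points of the chart circle with the same image have the same angle. [folklore] -/
theorem circlePt_eq_circlePt_iff {θ θ' : ℝ} :
    S.circlePt θ = S.circlePt θ' ↔ (θ : Real.Angle) = θ' := by
  constructor
  · intro h
    have hc : S.circleVec θ = S.circleVec θ' := by
      rw [← S.coord_circlePt θ, ← S.coord_circlePt θ', h]
    have h0 := congrArg (fun u : 𝔼 2 => u 0) hc
    have h1 := congrArg (fun u : 𝔼 2 => u 1) hc
    simp only [circleVec, euclideanTwo_apply_zero, euclideanTwo_apply_one] at h0 h1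
    have hρ := S.ρ_pos
    exact Real.Angle.cos_sin_inj (mul_left_cancel₀ hρ.ne' h0) (mul_left_cancel₀ hρ.ne' h1)
  · intro h
    obtain ⟨k, hk⟩ := Real.Angle.angle_eq_iff_two_pi_dvd_sub.1 h
    have : θ = θ' + k * (2 * Real.pi) := by linarith
    rw [this]
    unfold circlePt circleVec
    rw [Real.cos_add_int_mul_two_pi, Real.sin_add_int_mul_two_pi]

/-- **The chart circle is smooth.** [folklore] -/
theorem contMDiff_circlePt : ContMDiff 𝓘(ℝ, ℝ) (𝓡 2) ∞ S.circlePt := by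
  have hinner : ContMDiff 𝓘(ℝ, ℝ) 𝓘(ℝ, 𝔼 2) ∞
      fun θ => S.Dmin.chart.extend (𝓡 2) S.pmin + S.circleVec θ := by
    rw [contMDiff_iff_contDiff]
    refine contDiff_const.add ?_
    have hfun : S.circleVec = fun θ => (S.ρ * Real.cos θ) • (EuclideanSpace.single 0 1 : 𝔼 2) +
        (S.ρ * Real.sin θ) • (EuclideanSpace.single 1 1 : 𝔼 2) := by
      funext θ; exact euclideanTwo_eq_smul_add_smul _ _
    rw [hfun]
    exact ((contDiff_const.mul Real.contDiff_cos).smul contDiff_const).add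
      ((contDiff_const.mul Real.contDiff_sin).smul contDiff_const)
  have houter : ContMDiffOn 𝓘(ℝ, 𝔼 2) (𝓡 2) ∞ (S.Dmin.chart.extend (𝓡 2)).symm
      ((S.Dmin.chart.extend (𝓡 2)).target) := by
    rw [OpenPartialHomeomorph.extend_target']
    exact contMDiffOn_extend_symm S.Dmin.mem_maximalAtlas
  exact houter.comp_contMDiff hinner fun θ =>
    S.Dmin.add_mem_target (S.sqSum_circleVec_le θ).1 (S.sqSum_circleVec_le θ).2

omit [IsManifold (𝓡 2) ∞ M] in
/-- The inverse chart of the box, as functions: `(extend).symm = chart.symm` (model `𝓡 2`). [folklore] -/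
theorem coe_extend_symm {q : M} (D : MilnorBox (𝓡 2) f ξ q) :
    ((D.chart.extend (𝓡 2)).symm : 𝔼 2 → M) = D.chart.symm := by
  funext v; simp

omit [IsManifold (𝓡 2) ∞ M] in
/-- The chart of the box, as functions: `extend = chart` (model `𝓡 2`). [folklore] -/
theorem coe_extend {q : M} (D : MilnorBox (𝓡 2) f ξ q) :
    ((D.chart.extend (𝓡 2)) : M → 𝔼 2) = D.chart := by
  funext v; simp

/-- **The velocity of the chart circle** is `d(φ_p⁻¹)` of the model velocity, in particular
nonzero. [folklore] -/
theorem hasMFDerivAt_circlePt (θ : ℝ) :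
    HasMFDerivAt 𝓘(ℝ, ℝ) (𝓡 2) S.circlePt θ
      ((chartSymmDiff S.Dmin.chart (S.circlePt θ)).comp
        (ContinuousLinearMap.toSpanSingleton ℝ (S.circleVel θ))) := by
  -- the inner curve
  have hγ : HasMFDerivAt 𝓘(ℝ, ℝ) 𝓘(ℝ, 𝔼 2)
      (fun θ => S.Dmin.chart.extend (𝓡 2) S.pmin + S.circleVec θ) θ
      (ContinuousLinearMap.toSpanSingleton ℝ (S.circleVel θ)) :=
    hasMFDerivAt_iff_hasFDerivAt.2 ((S.hasDerivAt_circleVec θ).const_add _).hasFDerivAt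
  -- the outer inverse chart, differentiable at the image point
  have hy : S.Dmin.chart.extend (𝓡 2) S.pmin + S.circleVec θ ∈ (S.Dmin.chart.extend (𝓡 2)).target :=
    S.Dmin.add_mem_target (S.sqSum_circleVec_le θ).1 (S.sqSum_circleVec_le θ).2
  have hy' : S.Dmin.chart.extend (𝓡 2) S.pmin + S.circleVec θ ∈ S.Dmin.chart.target := by
    rw [OpenPartialHomeomorph.extend_target, ModelWithCorners.range_eq_univ, inter_univ] at hy
    simpa using hy
  have hΦ : MDifferentiableAt 𝓘(ℝ, 𝔼 2) (𝓡 2) S.Dmin.chart.symm (S.Dmin.chart.extend (𝓡 2) S.pmin + S.circleVec θ) :=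
    mdifferentiableAt_symm_of_mem_maximalAtlas S.Dmin.mem_maximalAtlas hy'
  have hcomp := hΦ.hasMFDerivAt.comp θ hγ
  -- identify the function and the point
  have hfun : (S.Dmin.chart.symm ∘ fun θ => S.Dmin.chart.extend (𝓡 2) S.pmin + S.circleVec θ) = S.circlePt := by
    funext θ'
    show S.Dmin.chart.symm (S.Dmin.chart.extend (𝓡 2) S.pmin + S.circleVec θ') = S.Dmin.pt (S.circleVec θ')
    rw [MilnorBox.pt, coe_extend_symm]
  rw [hfun] at hcomp
  have hpt : S.Dmin.chart.extend (𝓡 2) S.pmin + S.circleVec θ = S.Dmin.chart (S.circlePt θ) := by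
    have h1 := (S.Dmin.chart.extend (𝓡 2)).right_inv hy
    have h2 : (S.Dmin.chart.extend (𝓡 2)).symm (S.Dmin.chart.extend (𝓡 2) S.pmin + S.circleVec θ) =
        S.circlePt θ := rfl
    rw [h2, coe_extend] at h1
    exact h1.symm
  unfold chartSymmDiff
  rw [← hpt]
  exact hcomp

/-- The velocity vector of the chart circle. [folklore] -/
theorem mfderiv_circlePt_apply_one (θ : ℝ) :
    mfderiv 𝓘(ℝ, ℝ) (𝓡 2) S.circlePt θ (1 : ℝ) = chartSymmDiff S.Dmin.chart (S.circlePt θ) (S.circleVel θ) := by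
  rw [(S.hasMFDerivAt_circlePt θ).mfderiv]
  show chartSymmDiff S.Dmin.chart (S.circlePt θ) (ContinuousLinearMap.toSpanSingleton ℝ (S.circleVel θ) 1) = _
  simp

/-- The velocity of the chart circle never vanishes. [folklore] -/
theorem mfderiv_circlePt_apply_one_ne_zero (θ : ℝ) :
    mfderiv 𝓘(ℝ, ℝ) (𝓡 2) S.circlePt θ (1 : ℝ) ≠ (0 : 𝔼 2) := by
  rw [S.mfderiv_circlePt_apply_one θ]
  intro h
  have h2 := chartDiff_chartSymmDiff S.Dmin.mem_maximalAtlas (S.circlePt_mem_source θ) (S.circleVel θ)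
  rw [h, ContinuousLinearMap.map_zero] at h2
  exact S.circleVel_ne_zero θ h2.symm

/-- No critical value in `[min base lo, max base lo]`. [folklore] -/
theorem not_mem_Icc_min_max {q : M} (hq : IsMCriticalPt (𝓡 2) f q) :
    f q ∉ Icc (min S.base S.lo) (max S.base S.lo) := by
  rw [min_eq_left S.base_lt_lo.le, max_eq_right S.base_lt_lo.le]
  exact S.not_mem_Icc_base_lo hq

/-- No critical value in `[min lo base, max lo base]`. [folklore] -/
theorem not_mem_Icc_min_max' {q : M} (hq : IsMCriticalPt (𝓡 2) f q) :
    f q ∉ Icc (min S.lo S.base) (max S.lo S.base) := by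
  rw [min_comm, max_comm]; exact S.not_mem_Icc_min_max hq

/-- A linearly independent pair of a plane `E` gives a non-degenerate `frame₂`. [folklore] -/
theorem det_frame₂_ne_zero_of_linearIndependent {E : Type*} [NormedAddCommGroup E] [NormedSpace ℝ E]
    [FiniteDimensional ℝ E] (hE : finrank ℝ E = 2) {u v : E} (h : LinearIndependent ℝ ![u, v]) :
    (finBasis ℝ E).det (frame₂ u v) ≠ 0 := by
  set e : Fin (finrank ℝ E) ≃ Fin 2 := finCongr hE with he
  have hfr : frame₂ u v = ![u, v] ∘ e := by
    funext i
    have hi : (i : ℕ) < 2 := hE ▸ i.2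
    by_cases h0 : (i : ℕ) = 0
    · rw [frame₂_apply_of_eq_zero _ _ h0]
      have : e i = 0 := Fin.ext (by simp [he, h0])
      simp [this]
    · rw [frame₂_apply_of_ne_zero _ _ h0]
      have : e i = 1 := Fin.ext (by simp [he]; omega)
      simp [this]
  have hli : LinearIndependent ℝ (frame₂ u v) := by rw [hfr]; exact h.comp _ e.injective
  have hcard : Fintype.card (Fin (finrank ℝ E)) = finrank ℝ E := by simp
  haveI : Nonempty (Fin (finrank ℝ E)) := ⟨⟨0, by rw [hE]; norm_num⟩⟩
  set b := basisOfLinearIndependentOfCardEqFinrank hli hcard with hb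
  have hcoe : ⇑b = frame₂ u v := by rw [hb, coe_basisOfLinearIndependentOfCardEqFinrank]
  rw [← hcoe]
  exact ((finBasis ℝ E).isUnit_det b).ne_zero

/-- `√κ`, the `x`-coordinate of `e₊`. [folklore] -/
def sqκ : ℝ := Real.sqrt S.κ

/-- `0 < √κ`. [folklore] -/
theorem sqκ_pos : 0 < S.sqκ := Real.sqrt_pos.2 S.κ_pos

/-- `(√κ)² = κ`. [folklore] -/
theorem sqκ_sq : S.sqκ ^ 2 = S.κ := Real.sq_sqrt S.κ_pos.le

/-- `a² = κ < ε_sad²`. [folklore] -/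
theorem sq_lt_of_sq_eq_κ {a : ℝ} (ha : a ^ 2 = S.κ) : a ^ 2 < S.Dsad.ε ^ 2 := by
  rw [ha]; exact S.κ_lt

/-- `dφ_s(ξ) = (-x, y)` at a point of the saddle chart. [cite: MilnorHCobordism1965, Def. 3.1 (2)] -/
theorem chartDiff_xi {z : M} (hz : z ∈ S.Dsad.chart.source) :
    chartDiff S.Dsad.chart z (ξ z) = milnorModelField 1 (S.Dsad.coord z) := by
  have h := S.Dsad.mfderiv_eq z hz
  rw [S.ksad, coe_extend] at h
  rw [chartDiff_apply]
  unfold MilnorBox.coord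
  rw [coe_extend]
  exact h

/-- **`df = DQ ∘ dφ_s` on the saddle chart**: the differential of `f` at a point `z` of the
chart evaluated on `v` is the derivative of Milnor's quadratic form at `coord z` evaluated on
`dφ_s(v)`. [cite: MilnorHCobordism1965, Def. 3.1 (2)] -/
theorem mfderiv_f_eq {z : M} (hz : z ∈ S.Dsad.chart.source) (v : 𝔼 2) :
    mfderiv (𝓡 2) 𝓘(ℝ, ℝ) f z v =
      (∑ i : Fin 2, ((if (i : ℕ) < 1 then -1 else 1) * (2 * S.Dsad.coord z i)) •
        (EuclideanSpace.proj (𝕜 := ℝ) i)) (chartDiff S.Dsad.chart z v) := by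
  have hg : HasFDerivAt (fun u : 𝔼 2 => f S.sad + milnorQuadratic 1 (u - S.Dsad.chart.extend (𝓡 2) S.sad))
      (∑ i : Fin 2, ((if (i : ℕ) < 1 then -1 else 1) * (2 * S.Dsad.coord z i)) •
        (EuclideanSpace.proj (𝕜 := ℝ) i)) (S.Dsad.chart.extend (𝓡 2) z) := by
    have h1 := (hasFDerivAt_milnorQuadratic 1 (S.Dsad.chart.extend (𝓡 2) z - S.Dsad.chart.extend (𝓡 2) S.sad)).comp
      (S.Dsad.chart.extend (𝓡 2) z) ((hasFDerivAt_id _).sub_const (S.Dsad.chart.extend (𝓡 2) S.sad))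
    simp only [ContinuousLinearMap.comp_id] at h1
    exact h1.const_add _
  have hfg : ∀ q' ∈ S.Dsad.chart.source,
      f q' = f S.sad + milnorQuadratic 1 (S.Dsad.chart.extend (𝓡 2) q' - S.Dsad.chart.extend (𝓡 2) S.sad) :=
    fun q' hq' => by rw [S.Dsad.apply_eq q' hq', S.ksad]
  rw [mfderiv_apply_of_eq_comp_extend S.Dsad.mem_maximalAtlas hz hg hfg v, chartDiff_apply, coe_extend]


/-! ### Through the flow: the level curve -/

section Flow

variable [T2Space M] [CompactSpace M]

/-- **Backward limits below the saddle are the minimum**: a point with `f x ≤ f sad` other than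
the saddle comes from `pmin`. [cite: Matsumoto2001, §2.3 (c) (PDF p. 74)] -/
theorem tendsto_atBot_pmin {x : M} (hx : f x ≤ f S.sad) (hxs : x ≠ S.sad) :
    Tendsto (flow S.contMDiff x) atBot (𝓝 S.pmin) := by
  obtain ⟨r, hr, hrlim⟩ := S.isGradientLike.exists_isMCriticalPt_tendsto_flow_atBot S.isMorse S.contMDiff x
  have hmono := S.isGradientLike.monotone_comp_flow S.isMorse S.contMDiff x
  have hlimf : Tendsto (f ∘ flow S.contMDiff x) atBot (𝓝 (f r)) :=
    (S.isMorse.contMDiff.continuous.tendsto r).comp hrlim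
  have hrx : f r ≤ f x := by simpa [flow_zero] using hmono.le_of_tendsto hlimf 0
  -- `r` is a critical point with `f r ≤ f sad`, and `f r = f sad` forces `x = sad`
  rcases S.crit_cases hr with h | h | h
  · rwa [h] at hrlim
  · exfalso
    subst h
    -- `f` is constant `= f sad` along the trajectory backwards, so `x` is critical, so `x = sad`
    by_cases hxc : IsMCriticalPt (𝓡 2) f x
    · have hconst : ∀ t, flow S.contMDiff x t = x := fun t => S.isGradientLike.flow_eq_self S.contMDiff hxc t
      have : Tendsto (flow S.contMDiff x) atBot (𝓝 x) := by
        rw [show flow S.contMDiff x = fun _ => x from funext hconst]; exact tendsto_const_nhds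
      exact hxs (tendsto_nhds_unique this hrlim)
    · have h1 := S.isGradientLike.strictMono_comp_flow S.isMorse S.contMDiff hxc (show (-1 : ℝ) < 0 by norm_num)
      have h2 : f S.sad ≤ f (flow S.contMDiff x (-1)) := hmono.le_of_tendsto hlimf (-1)
      simp only [comp_apply, flow_zero] at h1
      linarith
  · have := S.η_pos; linarith

/-- **Forward limits above the lower level**: a point with `lo ≤ f x` not converging to the
saddle converges to a critical point above the gap. [cite: Matsumoto2001, §2.3 (c) (PDF p. 74)] -/
theorem exists_tendsto_atTop_ge {x : M} (hx : S.lo ≤ f x)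
    (hns : ¬ Tendsto (flow S.contMDiff x) atTop (𝓝 S.sad)) :
    ∃ r, IsMCriticalPt (𝓡 2) f r ∧ f S.sad + S.η ≤ f r ∧ Tendsto (flow S.contMDiff x) atTop (𝓝 r) := by
  obtain ⟨r, hr, hrlim⟩ := S.isGradientLike.exists_isMCriticalPt_tendsto_flow_atTop S.isMorse S.contMDiff x
  have hmono := S.isGradientLike.monotone_comp_flow S.isMorse S.contMDiff x
  have hlimf : Tendsto (f ∘ flow S.contMDiff x) atTop (𝓝 (f r)) :=
    (S.isMorse.contMDiff.continuous.tendsto r).comp hrlim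
  have hxr : f x ≤ f r := by simpa [flow_zero] using hmono.ge_of_tendsto hlimf 0
  rcases S.crit_cases hr with h | h | h
  · rw [h] at hxr; have := S.min_lt_base; have := S.base_lt_lo; linarith
  · rw [h] at hrlim; exact absurd hrlim hns
  · exact ⟨r, hr, h, hrlim⟩


/-- **The chart circle is the whole level `base`**: every point of the level comes from the
minimum and hence lies on the chart circle (`MilnorBox.mem_source_and_norm_coord_eq`). [cite: MilnorHCobordism1965, proof of Thm. 3.12 (PDF p. 18)] -/
theorem exists_circlePt_eq {x : M} (hx : f x = S.base) : ∃ θ, S.circlePt θ = x := by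
  have hxc := S.not_isMCriticalPt_of_base hx
  have hlim : Tendsto (flow S.contMDiff x) atBot (𝓝 S.pmin) :=
    S.tendsto_atBot_pmin (by rw [hx]; have := S.base_lt_lo; have := S.lo_lt_sad; linarith)
      (fun h => by rw [h] at hx; have := S.base_lt_lo; have := S.lo_lt_sad; linarith)
  obtain ⟨hsrc, hnorm⟩ := mem_source_and_norm_coord_eq S.isGradientLike S.isMorse S.contMDiff
    S.kmin S.ρ_pos S.ρ_lt hxc hx hlim
  obtain ⟨θ, hθ⟩ := exists_eq_polar hnorm
  refine ⟨θ, ?_⟩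
  unfold circlePt circleVec
  rw [← hθ]
  exact S.Dmin.pt_coord hsrc

/-- Every point of the chart circle reaches the level `lo`. [cite: MilnorHCobordism1965, Thm. 3.4 (PDF p. 13)] -/
theorem hits_lo_circlePt (θ : ℝ) : Hits (flowθ S.contMDiff) f S.lo (S.circlePt θ) :=
  S.isGradientLike.hits_of_forall_not_mem_Icc S.isMorse S.contMDiff
    (fun _ hq => S.not_mem_Icc_min_max hq) (S.apply_circlePt θ)

/-- **The level curve** `h θ`: the chart circle flowed up to the level `lo = f(sad) - κ`. [cite: MilnorHCobordism1965, Thm. 3.4 (PDF p. 13)] -/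
def levelCurve (θ : ℝ) : M := levelProj S.contMDiff f S.lo (S.circlePt θ)

/-- The level curve lies on the level `lo`. [cite: MilnorHCobordism1965, Thm. 3.4 (PDF p. 13)] -/
theorem apply_levelCurve (θ : ℝ) : f (S.levelCurve θ) = S.lo :=
  apply_levelProj S.contMDiff (S.hits_lo_circlePt θ)

/-- The level curve avoids the critical set. [folklore] -/
theorem not_isMCriticalPt_levelCurve (θ : ℝ) : ¬ IsMCriticalPt (𝓡 2) f (S.levelCurve θ) :=
  S.not_isMCriticalPt_of_lo (S.apply_levelCurve θ)

/-- Projecting the level curve back down gives the chart circle. [cite: MilnorHCobordism1965, Thm. 3.4 (PDF p. 13)] -/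
theorem levelProj_base_levelCurve (θ : ℝ) : levelProj S.contMDiff f S.base (S.levelCurve θ) = S.circlePt θ :=
  S.isGradientLike.levelProj_levelProj S.isMorse S.contMDiff
    (fun _ hx => S.not_isMCriticalPt_of_base hx) (S.apply_circlePt θ)

/-- The level curve is `2π`-periodic. [folklore] -/
theorem levelCurve_add_two_pi (θ : ℝ) : S.levelCurve (θ + 2 * Real.pi) = S.levelCurve θ := by
  unfold levelCurve; rw [S.circlePt_add_two_pi]

/-- **Injectivity on a period**: points of the level curve with the same image have the same
angle. [cite: MilnorHCobordism1965, Thm. 3.4 (PDF p. 13)] -/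
theorem levelCurve_eq_levelCurve_iff {θ θ' : ℝ} :
    S.levelCurve θ = S.levelCurve θ' ↔ (θ : Real.Angle) = θ' := by
  rw [← S.circlePt_eq_circlePt_iff]
  constructor
  · intro h
    exact S.isGradientLike.injOn_levelProj S.isMorse S.contMDiff
      (fun _ hx => S.not_isMCriticalPt_of_base hx) S.lo (S.apply_circlePt θ) (S.apply_circlePt θ') h
  · intro h; unfold levelCurve; rw [h]

/-- **The level curve is onto the level `lo`.** [cite: MilnorHCobordism1965, Thm. 3.4 (PDF p. 13)] -/
theorem exists_levelCurve_eq {y : M} (hy : f y = S.lo) : ∃ θ, S.levelCurve θ = y := by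
  have hyb : Hits (flowθ S.contMDiff) f S.base y :=
    S.isGradientLike.hits_of_forall_not_mem_Icc S.isMorse S.contMDiff
      (fun _ hq => S.not_mem_Icc_min_max' hq) hy
  obtain ⟨θ, hθ⟩ := S.exists_circlePt_eq (apply_levelProj S.contMDiff hyb)
  refine ⟨θ, ?_⟩
  unfold levelCurve
  rw [hθ]
  exact S.isGradientLike.levelProj_levelProj S.isMorse S.contMDiff
    (fun _ hx => S.not_isMCriticalPt_of_lo hx) hy

/-- The image of the level curve is the level `lo`. [cite: MilnorHCobordism1965, Thm. 3.4 (PDF p. 13)] -/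
theorem range_levelCurve : range S.levelCurve = {y | f y = S.lo} :=
  Set.ext fun _ => ⟨fun ⟨θ, hθ⟩ => hθ ▸ S.apply_levelCurve θ, fun hy => S.exists_levelCurve_eq hy⟩

/-- **The level curve is smooth.** [cite: MilnorHCobordism1965, proof of Thm. 5.4, Assertion 4 (PDF p. 29)] -/
theorem contMDiff_levelCurve : ContMDiff 𝓘(ℝ, ℝ) (𝓡 2) ∞ S.levelCurve := fun θ =>
  (S.isGradientLike.contMDiffAt_levelProj S.isMorse S.contMDiff
    (fun _ hx => S.not_isMCriticalPt_of_lo hx) (S.hits_lo_circlePt θ)).comp θ (S.contMDiff_circlePt θ)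

/-- The level curve is continuous. [folklore] -/
theorem continuous_levelCurve : Continuous S.levelCurve := S.contMDiff_levelCurve.continuous

/-- The velocity of the level curve. [folklore] -/
def levelVel (θ : ℝ) : 𝔼 2 := mfderiv 𝓘(ℝ, ℝ) (𝓡 2) S.levelCurve θ (1 : ℝ)

/-- **The velocity of the level curve never vanishes**: projecting down to the level `base`
(a smooth map) carries it to the velocity of the chart circle, which is nonzero. [cite: MilnorHCobordism1965, Thm. 3.4 (PDF p. 13)] -/
theorem levelVel_ne_zero (θ : ℝ) : S.levelVel θ ≠ 0 := by
  intro h0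
  have hπ : MDifferentiableAt (𝓡 2) (𝓡 2) (levelProj S.contMDiff f S.base) (S.levelCurve θ) :=
    (S.isGradientLike.contMDiffAt_levelProj S.isMorse S.contMDiff
      (fun _ hx => S.not_isMCriticalPt_of_base hx)
      (S.isGradientLike.hits_of_forall_not_mem_Icc S.isMorse S.contMDiff
        (fun _ hq => S.not_mem_Icc_min_max' hq) (S.apply_levelCurve θ))).mdifferentiableAt (by simp)
  have hh : MDifferentiableAt 𝓘(ℝ, ℝ) (𝓡 2) S.levelCurve θ :=
    (S.contMDiff_levelCurve θ).mdifferentiableAt (by simp)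
  have hcomp := mfderiv_comp θ hπ hh
  have hfun : levelProj S.contMDiff f S.base ∘ S.levelCurve = S.circlePt :=
    funext fun θ' => S.levelProj_base_levelCurve θ'
  rw [hfun] at hcomp
  have h1 : mfderiv 𝓘(ℝ, ℝ) (𝓡 2) S.circlePt θ (1 : ℝ) =
      mfderiv (𝓡 2) (𝓡 2) (levelProj S.contMDiff f S.base) (S.levelCurve θ) (S.levelVel θ) := by
    rw [hcomp]; rfl
  have h2 : mfderiv (𝓡 2) (𝓡 2) (levelProj S.contMDiff f S.base) (S.levelCurve θ) (S.levelVel θ) =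
      (0 : 𝔼 2) := by
    rw [h0]; exact map_zero _
  exact S.mfderiv_circlePt_apply_one_ne_zero θ (h1.trans h2)

/-- `df(ḣ) = 0`: the level curve stays on a level. [folklore] -/
theorem mfderiv_apply_levelVel (θ : ℝ) :
    mfderiv (𝓡 2) 𝓘(ℝ, ℝ) f (S.levelCurve θ) (S.levelVel θ) = 0 := by
  have hf : MDifferentiableAt (𝓡 2) 𝓘(ℝ, ℝ) f (S.levelCurve θ) :=
    S.isMorse.contMDiff.mdifferentiableAt (by simp)
  have hh : MDifferentiableAt 𝓘(ℝ, ℝ) (𝓡 2) S.levelCurve θ :=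
    (S.contMDiff_levelCurve θ).mdifferentiableAt (by simp)
  have hcomp := mfderiv_comp θ hf hh
  have hfun : f ∘ S.levelCurve = fun _ => S.lo := funext fun θ' => S.apply_levelCurve θ'
  rw [hfun, mfderiv_const] at hcomp
  have h2 := congrArg (fun T : TangentSpace 𝓘(ℝ, ℝ) θ →L[ℝ] TangentSpace 𝓘(ℝ, ℝ) S.lo => T (1 : ℝ)) hcomp
  exact h2.symm

/-- **The moving frame `(ξ (h θ), ḣ θ)` is linearly independent**: `df` is positive on `ξ` and
vanishes on `ḣ ≠ 0`. [cite: MilnorHCobordism1965, Def. 3.1] -/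
theorem linearIndependent_frame (θ : ℝ) :
    LinearIndependent ℝ ![ξ (S.levelCurve θ), S.levelVel θ] := by
  rw [LinearIndependent.pair_iff]
  intro a b hab
  set L : (𝔼 2) →L[ℝ] ℝ := mfderiv (𝓡 2) 𝓘(ℝ, ℝ) f (S.levelCurve θ) with hL
  have hpos : 0 < L (ξ (S.levelCurve θ)) :=
    S.isGradientLike.mlineDeriv_pos _ (S.not_isMCriticalPt_levelCurve θ)
  have h0 : L (S.levelVel θ) = 0 := S.mfderiv_apply_levelVel θ
  have hab' : a • (show 𝔼 2 from ξ (S.levelCurve θ)) + b • S.levelVel θ = 0 := hab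
  have h1 := congrArg L hab'
  rw [map_add, map_smul, map_smul, h0, smul_zero, add_zero, map_zero, smul_eq_mul] at h1
  have ha : a = 0 := by
    rcases mul_eq_zero.1 h1 with h | h
    · exact h
    · exact absurd h hpos.ne'
  rw [ha, zero_smul, zero_add] at hab'
  exact ⟨ha, (smul_eq_zero.1 hab').resolve_right (S.levelVel_ne_zero θ)⟩

/-- **The moving frame `(ξ (h θ), ḣ θ)` is nowhere degenerate.** [cite: MilnorHCobordism1965, Def. 3.1] -/
theorem det_frame_ne_zero (θ : ℝ) :
    (finBasis ℝ (𝔼 2)).det (frame₂ (ξ (S.levelCurve θ)) (S.levelVel θ)) ≠ 0 :=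
  det_frame₂_ne_zero_of_linearIndependent (by simp) (S.linearIndependent_frame θ)

/-- The points `e± = φ_s⁻¹(±√κ, 0)`, `a = ±√κ`: on the level `lo`, in the box, on the stable
set of the saddle. [cite: MilnorHCobordism1965, Def. 3.9 (PDF p. 16)] -/
theorem ePt_props {a : ℝ} (ha : a ^ 2 = S.κ) :
    S.Dsad.ePt a ∈ S.Dsad.box ∧ S.Dsad.xc (S.Dsad.ePt a) = a ∧ S.Dsad.yc (S.Dsad.ePt a) = 0 ∧
      f (S.Dsad.ePt a) = S.lo ∧ Tendsto (flow S.contMDiff (S.Dsad.ePt a)) atTop (𝓝 S.sad) := by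
  obtain ⟨h1, h2, h3, h4, h5⟩ := pt_axis_x S.contMDiff S.ksad (S.sq_lt_of_sq_eq_κ ha)
  exact ⟨h1, h2, h3, by rw [h4, ha]; rfl, h5⟩

/-- **The level curve passes through `e±`.** [folklore] -/
theorem exists_levelCurve_eq_ePt {a : ℝ} (ha : a ^ 2 = S.κ) : ∃ θ, S.levelCurve θ = S.Dsad.ePt a :=
  S.exists_levelCurve_eq (S.ePt_props ha).2.2.2.1

/-- **The points of the level curve on the stable set of the saddle are `e₊`, `e₋`.** [cite: MilnorHCobordism1965, Def. 3.9, proof of Thm. 3.12 (PDF pp. 16, 18)] -/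
theorem levelCurve_eq_ePt_or {θ : ℝ} (h : Tendsto (flow S.contMDiff (S.levelCurve θ)) atTop (𝓝 S.sad)) :
    S.levelCurve θ = S.Dsad.ePt S.sqκ ∨ S.levelCurve θ = S.Dsad.ePt (-S.sqκ) :=
  eq_ePt_or_of_tendsto S.isGradientLike S.isMorse S.contMDiff S.ksad S.κ_pos S.κ_lt
    (S.not_isMCriticalPt_levelCurve θ) (S.apply_levelCurve θ) h

/-- **The velocity of the level curve read in the saddle chart**: `w = dφ_s(ḣ θ)`, the derivative
of `φ_s ∘ h`. [folklore] -/
def chartVel (θ : ℝ) : 𝔼 2 := chartDiff S.Dsad.chart (S.levelCurve θ) (S.levelVel θ)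

/-- At a point of the saddle chart, `φ_s ∘ h` has derivative `chartVel θ`, hence so has
`coord ∘ h`. [folklore] -/
theorem hasDerivAt_coord_levelCurve {θ : ℝ} (hθ : S.levelCurve θ ∈ S.Dsad.chart.source) :
    HasDerivAt (fun θ' => S.Dsad.coord (S.levelCurve θ')) (S.chartVel θ) θ := by
  have hchart : HasMFDerivAt (𝓡 2) 𝓘(ℝ, 𝔼 2) S.Dsad.chart (S.levelCurve θ)
      (chartDiff S.Dsad.chart (S.levelCurve θ)) :=
    (mdifferentiableAt_of_mem_maximalAtlas S.Dsad.mem_maximalAtlas hθ).hasMFDerivAt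
  have hh : HasMFDerivAt 𝓘(ℝ, ℝ) (𝓡 2) S.levelCurve θ (mfderiv 𝓘(ℝ, ℝ) (𝓡 2) S.levelCurve θ) :=
    ((S.contMDiff_levelCurve θ).mdifferentiableAt (by simp)).hasMFDerivAt
  have hcomp := hchart.comp θ hh
  have hF : HasFDerivAt (⇑S.Dsad.chart ∘ S.levelCurve : ℝ → 𝔼 2)
      (((chartDiff S.Dsad.chart (S.levelCurve θ)).comp (mfderiv 𝓘(ℝ, ℝ) (𝓡 2) S.levelCurve θ)) :
        ℝ →L[ℝ] 𝔼 2) θ := hasMFDerivAt_iff_hasFDerivAt.1 hcomp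
  have hd : HasDerivAt (⇑S.Dsad.chart ∘ S.levelCurve : ℝ → 𝔼 2) (S.chartVel θ) θ := hF.hasDerivAt
  have hfun : (fun θ' => S.Dsad.coord (S.levelCurve θ')) =
      fun θ' => (S.Dsad.chart ∘ S.levelCurve) θ' - S.Dsad.chart S.sad := by
    funext θ'
    simp [MilnorBox.coord]
  rw [hfun]
  exact hd.sub_const _

/-- At `e± = φ_s⁻¹(a, 0)`: `dφ_s(ξ) = (-a, 0)`. [cite: MilnorHCobordism1965, Def. 3.1 (2)] -/
theorem chartDiff_xi_ePt {a : ℝ} (ha : a ^ 2 = S.κ) :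
    chartDiff S.Dsad.chart (S.Dsad.ePt a) (ξ (S.Dsad.ePt a)) = !₂[-a, 0] := by
  obtain ⟨hbox, hx, hy, -, -⟩ := S.ePt_props ha
  rw [S.chartDiff_xi hbox.1, coord_eq_euclideanTwo, hx, hy]
  ext i; fin_cases i <;> simp [milnorModelField_apply]

/-- **At `e±` the velocity of the level curve read in the saddle chart is vertical**:
`dφ_s(ḣ) = (0, b)` with `b ≠ 0` — from `df(ḣ) = 0`, `df = 2(-x dx + y dy) ∘ dφ_s` and
`(x, y) = (a, 0)`, `a ≠ 0`. [cite: MilnorHCobordism1965, Def. 3.1 (2)] -/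
theorem chartVel_ePt {θ : ℝ} {a : ℝ} (ha : a ^ 2 = S.κ) (hθ : S.levelCurve θ = S.Dsad.ePt a) :
    S.chartVel θ 0 = 0 ∧ S.chartVel θ 1 ≠ 0 ∧ S.chartVel θ = !₂[0, S.chartVel θ 1] := by
  obtain ⟨hbox, hx, hy, -, -⟩ := S.ePt_props ha
  have ha0 : a ≠ 0 := fun h => by rw [h] at ha; have := S.κ_pos; simp at ha; linarith
  have hz : S.levelCurve θ ∈ S.Dsad.chart.source := by rw [hθ]; exact hbox.1
  -- `df(ḣ) = 0` in the chart
  have h0 := S.mfderiv_apply_levelVel θ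
  rw [S.mfderiv_f_eq hz] at h0
  rw [show chartDiff S.Dsad.chart (S.levelCurve θ) (S.levelVel θ) = S.chartVel θ from rfl] at h0
  have hsum : ∀ u w : 𝔼 2, (∑ i : Fin 2, ((if (i : ℕ) < 1 then -1 else 1) * (2 * u i)) •
      (EuclideanSpace.proj (𝕜 := ℝ) i)) w = -2 * u 0 * w 0 + 2 * u 1 * w 1 := fun u w => by
    simp [Fin.sum_univ_two]
  rw [hsum, hθ] at h0
  have hc0 : S.Dsad.coord (S.Dsad.ePt a) 0 = a := hx
  have hc1 : S.Dsad.coord (S.Dsad.ePt a) 1 = 0 := hy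
  rw [hc0, hc1] at h0
  have h0' : (-2 * a * S.chartVel θ 0 + 2 * 0 * S.chartVel θ 1 : ℝ) = 0 := h0
  have hw0 : S.chartVel θ 0 = 0 := by
    have h2 : a * S.chartVel θ 0 = 0 := by linear_combination (-1 / 2 : ℝ) * h0'
    rcases mul_eq_zero.1 h2 with h | h
    · exact absurd h ha0
    · exact h
  have hw : S.chartVel θ ≠ 0 := by
    intro h
    have := chartSymmDiff_chartDiff S.Dsad.mem_maximalAtlas hz (S.levelVel θ)
    rw [show chartDiff S.Dsad.chart (S.levelCurve θ) (S.levelVel θ) = S.chartVel θ from rfl, h,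
      ContinuousLinearMap.map_zero] at this
    exact S.levelVel_ne_zero θ this.symm
  have heta : S.chartVel θ = !₂[0, S.chartVel θ 1] := by
    conv_lhs => rw [← euclideanTwo_eta (S.chartVel θ), hw0]
  refine ⟨hw0, fun h1 => hw ?_, heta⟩
  calc S.chartVel θ = !₂[0, S.chartVel θ 1] := heta
    _ = 0 := by rw [h1]; ext i; fin_cases i <;> rfl

/-- **The frame read in the saddle chart at `e±`**: `(dφ_s ξ, dφ_s ḣ) = ((-a, 0), (0, b))`. [cite: MilnorHCobordism1965, Def. 3.1 (2)] -/
theorem readFrame_ePt {θ : ℝ} {a : ℝ} (ha : a ^ 2 = S.κ) (hθ : S.levelCurve θ = S.Dsad.ePt a) :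
    readFrame S.Dsad.chart (S.levelCurve θ) (frame₂ (ξ (S.levelCurve θ)) (S.levelVel θ)) =
      frame₂ (!₂[-a, 0]) (!₂[0, S.chartVel θ 1]) := by
  have h1 : readFrame S.Dsad.chart (S.levelCurve θ) (frame₂ (ξ (S.levelCurve θ)) (S.levelVel θ)) =
      frame₂ (chartDiff S.Dsad.chart (S.levelCurve θ) (ξ (S.levelCurve θ))) (S.chartVel θ) :=
    map_frame₂ _ _ _
  rw [h1, ← (S.chartVel_ePt ha hθ).2.2]
  congr 1
  rw [hθ]; exact S.chartDiff_xi_ePt ha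


end Flow

end LowestSaddle

end Config

end Literature.Topology.FourManifolds
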